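import Literature.AnabelianGeometry.AbsoluteAnabelian.AbsTopIII.HolLogFrobeniusObservable
import Literature.AnabelianGeometry.AbsoluteAnabelian.AbsTopIII.AutHolLogFrobeniusObservable
import Literature.AnabelianGeometry.AbsoluteAnabelian.AbsTopIII.AutHolLogFrobenius
import HarnessLib

/-!
# [AbsTopIII] Corollary 3.6 (iii) / Corollary 4.5 (iii): the observable `𝔖_log` exists for EVERY input datum

S. Mochizuki, *Topics in Absolute Anabelian Geometry III* (bib key `MochizukiAbsTopIII2015`; lit key
`paper:url-5493eb38cbb7`, kurims manuscript pages), Corollary 3.6 (iii) p. 80 and Corollary 4.5 (iii)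
pp. 108–109: "The natural transformations `ι_{log,⋎}`, `ι_×` belong to a family of homotopies on `𝒟_{≤3}`
that determines on `𝒟_{≤3}` a structure of observable `𝔖_log` on `𝒟_{≤2}`."

Seat abc-iut-L4-t5's pinned statement `LogFrobeniusData.ObservableLogStmt`
(`AbsTopIII/FrobeniusPictureMLF.lean`) quantifies over an abstract input datum `Δ : LogFrobeniusData`,
whose field `Δ.ιtimes : (λ^× ⟶ λ^{×pf}) ⊕ (λ^{×pf} ⟶ λ^×)` records the ORIENTATION of `ι_×`: `Sum.inl`
is the MLF-Galois (holomorphic, §3) orientation of Cor. 3.6, `Sum.inr` the Aut-holomorphic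
(archimedean, §4) orientation of Cor. 4.5.  Seat abc-iut-L4-t10 constructed the family in each
orientation separately: `AbsTopIII.observableLogStmt_of_inl` (`HolLogFrobeniusObservable.lean`, the
finite boundary set of Cor. 3.6 (iii)) and `AbsTopIII.observableLogStmt_of_inr`
(`AutHolLogFrobeniusObservable.lean`, the saturated boundary set of Cor. 4.5 (iii)).

This proof-only file records the UNCONDITIONAL consequence — the DAG nodes `AbsTopIII:Cor3.6(iii)`
and `AbsTopIII:Cor4.5(iii)` at the level of the typed statement: `ObservableLogStmt` holds for every
`Δ`, by case analysis on the orientation.  No definition, no hypothesis; nothing here takes a side on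
inter-universal Teichmüller theory ([AbsTopIII] is a refereed paper).  Discharge wave 4 (D-0067),
seat abc-iut-w4-d095.
-/

namespace Literature.AnabelianGeometry.AbsoluteAnabelian.LogFrobeniusData

open _root_.CategoryTheory

universe u

/-- **[AbsTopIII] Cor. 3.6 (iii) / Cor. 4.5 (iii), unconditionally over the abstract data**: for every
log-Frobenius input datum `Δ` (either orientation of `ι_×`), the natural transformations
`ι_{log,⋎}`, `ι_×` generate a family of homotopies on `𝒟_{≤3}` determining an observable `𝔖_log` on
`𝒟_{≤2}` — the pinned statement `Δ.ObservableLogStmt` holds.  Case `inl`: abc-iut-L4-t10's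
`observableLogStmt_of_inl` (Cor. 3.6 (iii) p. 81); case `inr`: `observableLogStmt_of_inr`
(Cor. 4.5 (iii) p. 109). [cite: MochizukiAbsTopIII2015, Corollary 3.6 (iii) p.80] -/
theorem observableLogStmt (Δ : LogFrobeniusData.{u}) :
    Literature.AnabelianGeometry.AbsoluteAnabelian.LogFrobeniusData.ObservableLogStmt Δ := by
  rcases h : Δ.ιtimes with ι | ι
  · exact AbsTopIII.observableLogStmt_of_inl Δ ι h
  · exact AbsTopIII.observableLogStmt_of_inr Δ ι h

end Literature.AnabelianGeometry.AbsoluteAnabelian.LogFrobeniusData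

namespace Literature.AnabelianGeometry.AbsoluteAnabelian.AbsTopIII

universe u'

/-- **[AbsTopIII] Cor. 4.5 (iii) holds for every input datum**: abc-iut-L4-t10's named statement
`AbsTopIII.Cor_4_5_iii Δ := Δ.ObservableLogStmt` (`AutHolLogFrobenius.lean`), DISCHARGED unconditionally
— no orientation hypothesis `IsAutHolDirection` is needed, since `observableLogStmt` covers both
orientations of `ι_×`. [cite: MochizukiAbsTopIII2015, Corollary 4.5 (iii) p.108] -/
theorem cor_4_5_iii_holds (Δ : LogFrobeniusData.{u'}) :
    Literature.AnabelianGeometry.AbsoluteAnabelian.AbsTopIII.Cor_4_5_iii Δ :=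
  LogFrobeniusData.observableLogStmt Δ

variable (Δ : LogFrobeniusData.{u'}) in
/-- `Cor_4_5_iii` — `_holds` alias of `cor_4_5_iii_holds` above under the fact's exact name, stated under the
prover's own binder as a section variable (appended 2026-08-28, D-0026 bookkeeping: the proof term is the
existing theorem of this file; no statement, definition or attribute is edited; no new named fact; the
ledger's debt table listed the fact unproved). [cite: MochizukiAbsTopIII2015, Corollary 4.5 (iii) p.108] -/
theorem Cor_4_5_iii_holds :
    Literature.AnabelianGeometry.AbsoluteAnabelian.AbsTopIII.Cor_4_5_iii Δ :=
  cor_4_5_iii_holds Δ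

end Literature.AnabelianGeometry.AbsoluteAnabelian.AbsTopIII
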